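import Summits.QuantumFields.QCD.Theorems.ExtinctionBuildsQCD.Negative.VolumeLever

/-!
# `ExtinctionBuildsQCD` (crux stmt-QuantumFields-18064, RESTATED 2026-08-17 as SD⁺ → THR) — negative-side
# support: the MISSING VOLUME FLOOR (`ℓ_k/Z_k` is not controlled by SD⁺ minus TIGHT⁺)

Cdisprove seat g2 (2026-08-17), §8b of `Cruxes/ExtinctionBuildsQCD/Disproof.lean`.  The picked line
`block-away-the-sign` transfers the fermion sign between periodic and antiperiodic boundary conditions by a
Weyl comparison at the BARE flavour scale `w = a_k m_f/Z_k` (landed stubs W `stub_indexAPSubPerLeWindow`,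
F `stub_apSignDefectForcesPerDefect`, proviso `8π/L < c·w`).  At the scheme torus the proviso reads
`8π Z_k < c m_f · a_k(2L_k+1)`: a LOWER bound on the physical torus size `ℓ_k = a_k(2L_k+1)` in units of `Z_k/m_f`.
This module shows that NO STRUCTURAL CLAUSE of SD⁺ supplies it, EXTINCT included:

* `exists_slowVolume` — for `N_f ≤ 16` there is a regularisation (the tip family `tipReg` with volumes
  `L_k = (k+1)·⌈√Z_k⌉`) that has leading-log mass scaling, asymptotic scaling, the polynomial volume cap (R1),
  the branch clause, EXTINCT for every `c ≤ 1` and every positive mass tuple — i.e. every clause of SD⁺ except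
  TIGHT⁺ (cf. `Negative/WithoutTightPlusCollapse`) — and nevertheless `Z_k/(a_k(2L_k+1)) → ∞`.
* `exists_slowVolume_bcProviso_eventually_false` — on it, for EVERY `c > 0` and EVERY mass `m > 0`, the proviso
  `8π/(2L_k+1) < c·(a_k m/Z_k)` FAILS eventually: F and W are void at the scheme torus whatever threshold the
  line picks.

LOAD-BEARING READING.  Any proof that uses the b.c. transfer at `S = L_k` must extract the growth `ℓ_k/Z_k → ∞`
from TIGHT⁺ — the only clause the witness fails — or the planner adds the harmless floor
`Tendsto (fun k => reg.a k * reg.L k / reg.Zm k) atTop atTop` to the class (met by every polynomial-volume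
witness), or the transfer is redone by massive-propagator locality at the PHYSICAL rate `a_k m_phys` (b.c. effects
`e^{−m_phys ℓ_k}`, for which `ℓ_k → ∞` suffices).  Heuristically TIGHT⁺ does not supply the growth either (its
floor `η ℓ_k²` is the Leutwyler–Smilga `√(χ_t V_phys)`, insensitive to `ℓ_k/Z_k`).
-/

noncomputable section

namespace Summit.QuantumFields.QCD.Theorems.ExtinctionBuildsQCD.Negative.VolumeFloor

open scoped BigOperators Topology Classical
open Filter
open Literature.MathematicalPhysics.QuantumLattice Literature.MathematicalPhysics.QuantumFieldTheory
  Literature.Probability.LatticeModels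
open Summit.QuantumFields.QCD.Theses.SpectralDefectExtinction
open Summit.QuantumFields.QCD.Theorems.ExtinctionBuildsQCD.Negative

variable {Nf : ℕ}

/-- `Z_k → ∞` along the tip family (`N_f ≤ 16`, so that the leading-log exponent is positive). -/
theorem tendsto_canonicalAF_Zm (hNf : Nf ≤ 16) :
    Tendsto (fun k => (QCDRegularisation.canonicalAF Nf).Zm k) atTop atTop := by
  have canonicalAF_Zm : ∀ {k : ℕ}, k ≠ 0 →
      (QCDRegularisation.canonicalAF Nf).Zm k = Real.log (((k : ℝ) + 1) ^ 2) ^ massExponent Nf := by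
    intro k hk
    change (if k = 0 then (1 : ℝ) else Real.log (1 / (QCDScheme.zeroAF Nf).a k ^ 2) ^ massExponent Nf) = _
    rw [if_neg hk]
    congr 2
    change 1 / (((k : ℝ) + 1)⁻¹) ^ 2 = _
    rw [inv_pow, one_div, inv_inv]
  have hγ : 0 < massExponent Nf := by
    have hN : (Nf : ℝ) ≤ 16 := by exact_mod_cast hNf
    unfold massExponent gammaCoeff₀ betaCoeff₀
    apply div_pos (by positivity)
    apply mul_pos two_pos
    apply div_pos _ (by positivity)
    linarith
  have h1 : Tendsto (fun k : ℕ => ((k : ℝ) + 1) ^ 2) atTop atTop :=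
    (tendsto_pow_atTop two_ne_zero).comp (tendsto_natCast_atTop_atTop.atTop_add tendsto_const_nhds)
  have h2 : Tendsto (fun k : ℕ => Real.log (((k : ℝ) + 1) ^ 2) ^ massExponent Nf) atTop atTop :=
    (tendsto_rpow_atTop hγ).comp (Real.tendsto_log_atTop.comp h1)
  refine h2.congr' ?_
  filter_upwards [eventually_ne_atTop 0] with k hk
  rw [canonicalAF_Zm hk]

/-- The slow volumes `L_k = (k+1)·⌈√Z_k⌉` are admissible: `a_k L_k = ⌈√Z_k⌉ → ∞`. -/
theorem tendsto_a_mul_slowL (hNf : Nf ≤ 16) :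
    Tendsto (fun k : ℕ => (QCDRegularisation.canonicalAF Nf).a k *
      (((k + 1) * ⌈Real.sqrt ((QCDRegularisation.canonicalAF Nf).Zm k)⌉₊ : ℕ) : ℝ)) atTop atTop := by
  have canonicalAF_a : ∀ k : ℕ, (QCDRegularisation.canonicalAF Nf).a k = ((k : ℝ) + 1)⁻¹ := fun _ => rfl
  have hs : Tendsto (fun k => Real.sqrt ((QCDRegularisation.canonicalAF Nf).Zm k)) atTop atTop := by
    have := (tendsto_rpow_atTop (by norm_num : (0 : ℝ) < 1 / 2)).comp (tendsto_canonicalAF_Zm hNf)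
    refine this.congr fun k => ?_
    simp [Function.comp, Real.sqrt_eq_rpow]
  have hc : Tendsto (fun k => (⌈Real.sqrt ((QCDRegularisation.canonicalAF Nf).Zm k)⌉₊ : ℝ)) atTop atTop :=
    tendsto_natCast_atTop_atTop.comp (tendsto_nat_ceil_atTop.comp hs)
  refine hc.congr fun k => ?_
  rw [canonicalAF_a]
  push_cast
  have hk : ((k : ℝ) + 1) ≠ 0 := by positivity
  field_simp

variable (Nf) in
/-- **The slow-volume member of SD⁺ minus TIGHT⁺.** For `N_f ≤ 16` there is a regularisation with leading-log
mass scaling, asymptotic scaling, the polynomial volume cap, the branch clause and EXTINCT for every `c ≤ 1` and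
every positive tuple, along which `Z_k/(a_k(2L_k+1)) → ∞`. -/
theorem exists_slowVolume (hNf : Nf ≤ 16) :
    ∃ reg : QCDRegularisation Nf, reg.HasMassScaling ∧ (reg.scheme 0 0 0).HasAsymptoticScaling ∧
      (∃ p : ℕ, ∀ᶠ k : ℕ in atTop, (reg.L k : ℝ) ≤ (reg.a k)⁻¹ ^ p) ∧ (∀ᶠ k : ℕ in atTop, -1 < reg.mcrit k) ∧
      (∀ c : ℝ, c ≤ 1 → ∀ m : Fin Nf → ℝ, (∀ f, 0 < m f) → Extinct Nf reg c m) ∧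
      Tendsto (fun k => reg.Zm k / (reg.a k * (2 * reg.L k + 1))) atTop atTop := by
  have canonicalAF_a : ∀ k : ℕ, (QCDRegularisation.canonicalAF Nf).a k = ((k : ℝ) + 1)⁻¹ := fun _ => rfl
  have canonicalAF_Zm : ∀ {k : ℕ}, k ≠ 0 →
      (QCDRegularisation.canonicalAF Nf).Zm k = Real.log (((k : ℝ) + 1) ^ 2) ^ massExponent Nf := by
    intro k hk
    change (if k = 0 then (1 : ℝ) else Real.log (1 / (QCDScheme.zeroAF Nf).a k ^ 2) ^ massExponent Nf) = _
    rw [if_neg hk]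
    congr 2
    change 1 / (((k : ℝ) + 1)⁻¹) ^ 2 = _
    rw [inv_pow, one_div, inv_inv]
  set Z : ℕ → ℝ := fun k => (QCDRegularisation.canonicalAF Nf).Zm k with hZdef
  set L' : ℕ → ℕ := fun k => (k + 1) * ⌈Real.sqrt (Z k)⌉₊ with hL'def
  have hL' : Tendsto (fun k => (QCDRegularisation.canonicalAF Nf).a k * L' k) atTop atTop :=
    tendsto_a_mul_slowL hNf
  refine ⟨tipReg Nf L' hL', QCDRegularisation.canonicalAF_hasMassScaling,
    QCDScheme.zeroAF_hasAsymptoticScaling, ?_, Eventually.of_forall fun k => by norm_num [tipReg, withVolume,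
      QCDRegularisation.canonicalAF], fun c hc m hm => extinct_of_mcrit_nonneg _ (fun _ => le_rfl) hc m hm, ?_⟩
  · -- the cap, with `p = 26`: `L_k = (k+1)⌈√Z_k⌉ ≤ (k+1)(Z_k + 2) ≤ (k+1)^26` since `Z_k ≤ ((k+1)²)^12`
    have hN : (Nf : ℝ) ≤ 16 := by exact_mod_cast hNf
    have hπ2 : (0 : ℝ) < 16 * Real.pi ^ 2 := by positivity
    have h3pos : (0 : ℝ) < 11 - 2 * (Nf : ℝ) / 3 := by linarith
    have hγ12 : massExponent Nf ≤ 12 := by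
      unfold massExponent gammaCoeff₀ betaCoeff₀
      rw [div_le_iff₀ (by positivity), div_le_iff₀ hπ2]
      have e : 12 * (2 * ((11 - 2 * (Nf : ℝ) / 3) / (16 * Real.pi ^ 2))) * (16 * Real.pi ^ 2) =
          24 * (11 - 2 * (Nf : ℝ) / 3) := by
        field_simp
        ring
      rw [e]
      linarith
    have hγ0 : 0 ≤ massExponent Nf := by
      unfold massExponent gammaCoeff₀ betaCoeff₀
      exact div_nonneg (by positivity) (mul_nonneg zero_le_two (div_nonneg h3pos.le hπ2.le))
    refine ⟨26, ?_⟩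
    filter_upwards [eventually_ne_atTop 0, eventually_ge_atTop 1] with k hk hk1
    have hx1 : (1 : ℝ) ≤ ((k : ℝ) + 1) ^ 2 := by
      have : (1 : ℝ) ≤ (k : ℝ) + 1 := by
        have : (0 : ℝ) ≤ k := Nat.cast_nonneg k
        linarith
      nlinarith
    -- `Z_k ≤ ((k+1)²)^12`
    have hZle : Z k ≤ (((k : ℝ) + 1) ^ 2) ^ (12 : ℕ) := by
      change (QCDRegularisation.canonicalAF Nf).Zm k ≤ _
      rw [canonicalAF_Zm hk]
      have hlog0 : 0 ≤ Real.log (((k : ℝ) + 1) ^ 2) := Real.log_nonneg hx1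
      have hlogle : Real.log (((k : ℝ) + 1) ^ 2) ≤ ((k : ℝ) + 1) ^ 2 :=
        (Real.log_le_sub_one_of_pos (by positivity)).trans (by linarith)
      calc Real.log (((k : ℝ) + 1) ^ 2) ^ massExponent Nf
          ≤ (((k : ℝ) + 1) ^ 2) ^ massExponent Nf := Real.rpow_le_rpow hlog0 hlogle hγ0
        _ ≤ (((k : ℝ) + 1) ^ 2) ^ (12 : ℝ) := Real.rpow_le_rpow_of_exponent_le hx1 hγ12
        _ = (((k : ℝ) + 1) ^ 2) ^ (12 : ℕ) := by exact_mod_cast Real.rpow_natCast (((k : ℝ) + 1) ^ 2) 12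
    have hZ0 : 0 ≤ Z k := ((QCDRegularisation.canonicalAF Nf).Zm_pos k).le
    -- `⌈√Z⌉ ≤ Z + 2`
    have hceil : (⌈Real.sqrt (Z k)⌉₊ : ℝ) ≤ Z k + 2 := by
      have h1 : (⌈Real.sqrt (Z k)⌉₊ : ℝ) < Real.sqrt (Z k) + 1 := Nat.ceil_lt_add_one (Real.sqrt_nonneg _)
      have h2 : Real.sqrt (Z k) ≤ Z k + 1 := by
        rw [Real.sqrt_le_left (by linarith)]
        nlinarith
      linarith
    change ((L' k : ℕ) : ℝ) ≤ ((QCDRegularisation.canonicalAF Nf).a k)⁻¹ ^ 26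
    rw [canonicalAF_a, inv_inv, hL'def]
    push_cast
    set x : ℝ := (k : ℝ) + 1 with hx
    have hx2 : (2 : ℝ) ≤ x := by
      have : (1 : ℝ) ≤ k := by exact_mod_cast hk1
      rw [hx]; linarith
    calc x * (⌈Real.sqrt (Z k)⌉₊ : ℝ) ≤ x * (Z k + 2) := by gcongr
      _ ≤ x * ((x ^ 2) ^ 12 + 2) := by gcongr
      _ ≤ x * ((x ^ 2) ^ 12 + (x ^ 2) ^ 12) := by
          have h4 : (4 : ℝ) ≤ x ^ 2 := by nlinarith
          have h2le : (2 : ℝ) ≤ (x ^ 2) ^ 12 :=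
            le_trans (by norm_num) (le_trans h4 (le_self_pow₀ (by linarith) (by norm_num)))
          gcongr
      _ = 2 * x ^ 25 := by ring
      _ ≤ x * x ^ 25 := by gcongr
      _ = x ^ 26 := by ring
  · -- `Z_k/(a_k(2L_k+1)) = Z_k/(2⌈√Z_k⌉ + a_k) ≥ √Z_k/5 → ∞`
    have hs : Tendsto (fun k => Real.sqrt (Z k)) atTop atTop := by
      have := (tendsto_rpow_atTop (by norm_num : (0 : ℝ) < 1 / 2)).comp (tendsto_canonicalAF_Zm hNf)
      refine this.congr fun k => ?_
      simp [Function.comp, Real.sqrt_eq_rpow, hZdef]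
    have hs5 : Tendsto (fun k => Real.sqrt (Z k) / 5) atTop atTop := hs.atTop_div_const (by norm_num)
    refine tendsto_atTop_mono' atTop ?_ hs5
    filter_upwards [hs.eventually_ge_atTop 1] with k hk1
    have hZ0 : 0 ≤ Z k := ((QCDRegularisation.canonicalAF Nf).Zm_pos k).le
    have hceil1 : Real.sqrt (Z k) ≤ (⌈Real.sqrt (Z k)⌉₊ : ℝ) := Nat.le_ceil _
    have hceil2 : (⌈Real.sqrt (Z k)⌉₊ : ℝ) < Real.sqrt (Z k) + 1 := Nat.ceil_lt_add_one (Real.sqrt_nonneg _)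
    have ha : (QCDRegularisation.canonicalAF Nf).a k ≤ 1 := by
      rw [canonicalAF_a]
      exact inv_le_one_of_one_le₀ (by have : (0 : ℝ) ≤ k := Nat.cast_nonneg k; linarith)
    have ha0 : 0 < (QCDRegularisation.canonicalAF Nf).a k := (QCDRegularisation.canonicalAF Nf).a_pos k
    change Real.sqrt (Z k) / 5 ≤ Z k / ((QCDRegularisation.canonicalAF Nf).a k * (2 * ((L' k : ℕ) : ℝ) + 1))
    have hden : (QCDRegularisation.canonicalAF Nf).a k * (2 * ((L' k : ℕ) : ℝ) + 1) =
        2 * (⌈Real.sqrt (Z k)⌉₊ : ℝ) + (QCDRegularisation.canonicalAF Nf).a k := by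
      rw [hL'def]
      push_cast
      rw [canonicalAF_a]
      have hk : ((k : ℝ) + 1) ≠ 0 := by positivity
      field_simp
    rw [hden]
    have hdenpos : 0 < 2 * (⌈Real.sqrt (Z k)⌉₊ : ℝ) + (QCDRegularisation.canonicalAF Nf).a k := by
      nlinarith
    have hdenle : 2 * (⌈Real.sqrt (Z k)⌉₊ : ℝ) + (QCDRegularisation.canonicalAF Nf).a k ≤ 5 * Real.sqrt (Z k) := by
      nlinarith
    rw [div_le_div_iff₀ (by norm_num) hdenpos]
    have hsq : Real.sqrt (Z k) * Real.sqrt (Z k) = Z k := Real.mul_self_sqrt hZ0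
    nlinarith [Real.sqrt_nonneg (Z k)]

variable (Nf) in
/-- **On the slow-volume member the b.c. proviso fails for every window constant and every mass.** For
`N_f ≤ 16` there is a member of SD⁺ minus TIGHT⁺ (scalings, cap, branch, EXTINCT for all `c ≤ 1`) on which, for
every `c > 0` and `m > 0`, eventually `¬ (8π/(2L_k+1) < c·(a_k m/Z_k))` — stub F's hypothesis at the scheme torus. -/
theorem exists_slowVolume_bcProviso_eventually_false (hNf : Nf ≤ 16) :
    ∃ reg : QCDRegularisation Nf, reg.HasMassScaling ∧ (reg.scheme 0 0 0).HasAsymptoticScaling ∧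
      (∃ p : ℕ, ∀ᶠ k : ℕ in atTop, (reg.L k : ℝ) ≤ (reg.a k)⁻¹ ^ p) ∧ (∀ᶠ k : ℕ in atTop, -1 < reg.mcrit k) ∧
      (∀ c : ℝ, c ≤ 1 → ∀ m : Fin Nf → ℝ, (∀ f, 0 < m f) → Extinct Nf reg c m) ∧
      ∀ c m : ℝ, 0 < c → 0 < m → ∀ᶠ k : ℕ in atTop,
        ¬ 8 * Real.pi / (2 * reg.L k + 1 : ℝ) < c * (reg.a k * m / reg.Zm k) := by
  obtain ⟨reg, h1, h2, h3, h4, h5, hT⟩ := exists_slowVolume Nf hNf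
  refine ⟨reg, h1, h2, h3, h4, h5, fun c m hc hm => ?_⟩
  filter_upwards [hT.eventually_ge_atTop (c * m / (8 * Real.pi))] with k hk
  have ha := reg.a_pos k
  have hZ := reg.Zm_pos k
  have hN : (0 : ℝ) < 2 * reg.L k + 1 := by positivity
  rw [not_lt, mul_div_assoc', div_le_iff₀ hZ, div_mul_eq_mul_div, le_div_iff₀ hN]
  -- goal: `c * (a m) * N ≤ 8π Z`, from `cm/(8π) ≤ Z/(a N)`
  rw [div_le_div_iff₀ (by positivity) (mul_pos ha hN)] at hk
  calc c * (reg.a k * m) * (2 * (reg.L k : ℝ) + 1) = c * m * (reg.a k * (2 * reg.L k + 1)) := by ring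
    _ ≤ reg.Zm k * (8 * Real.pi) := hk
    _ = 8 * Real.pi * reg.Zm k := by ring

end Summit.QuantumFields.QCD.Theorems.ExtinctionBuildsQCD.Negative.VolumeFloor

end
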